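import Summits.RiemannHypothesis.RiemannHypothesis.Theorems.SignConeConeMagnificationCaraLine
import Summits.RiemannHypothesis.RiemannHypothesis.Theorems.SignConeConeMagnificationCaraGrowth
import Summits.RiemannHypothesis.RiemannHypothesis.Theorems.SignConeConeMagnificationCaraShift
import HarnessLib

/-!
# Carathéodory ⟹ unit slack, part IV: the damped fake explicit formula at fixed `δ`

Sub-problem `RiemannHypothesis`, route `SignCone`, crux `ConeMagnification` (stmt-RiemannHypothesis-16303),
seat 0, session 9.  Penultimate file of the series `…CaraLine` / `…CaraGrowth` / `…CaraShift` / (this) /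
`…CaraConverse` proving `unitSlack_of_cara` (the converse of the landed `stub_cara`).

For a real weight `c` with `Σ|c(n)|n^{-σ} < ∞` (`σ > 1`), `F = L_c − 1/(s−1)` holomorphic on `Re s > 1/2` with the
Carathéodory majorant `Re F ≤ A(s) = 1/2 + Re(1/s) + ½Re ψ(s/2) − ½log π`, a test function `S` and the damped
test `K_δ(u) = e^{-δu} S(u)` (`0 < δ < 1/2`):
* `fake_explicit_damped`: `2π Σₙ c(n) n^{-1/2} K_δ(log n) = ∫ F(1/2+δ+iy) Ŝ(1/2+iy) dy + ∫ Ŝ(1/2+iy)/(δ−1/2+iy) dy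
  + 2π Ŝ(1−δ)` (right edge on `Re s = 2` for general coefficients, `L_c = F + 1/(s−1)`, Borel–Carathéodory growth
  and the shift of `F K̂_δ` to `Re s = 1/2+δ` where `K̂_δ = Ŝ(· − δ)`, the pole part read on both lines);
* `re_fake_explicit_damped_le`: if moreover `Ŝ(1/2+iy) = P(y) ≥ 0` is real (e.g. `S = G + G(−·)`, `G = g ⋆ g̃`),
  the ONE-SIDED majorant enters: `2π Re Σₙ c(n) n^{-1/2} e^{-δ log n} S(log n) ≤ ∫ (A(s) + Re 1/(s−1)) P dy + 2π Re Ŝ(1−δ)`,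
  `s = 1/2+δ+iy` (with the integrable, `δ`-uniform bound `exists_integrable_bound_caraKernel` and the continuity
  `continuousOn_caraKernel` of the kernel, used for dominated convergence in the last file).

References: E. Bombieri, Rend. Lincei (9) 11 (2000) §2; this route's `StubCara`.
-/

noncomputable section

-- `Summit.RiemannHypothesis.RiemannHypothesis.…` repeats a namespace component by design (D-0017 layout).
set_option linter.dupNamespace false

open Complex Filter Set MeasureTheory Metric LSeries Literature.NumberTheory.LFunctions
open scoped Real Topology ComplexConjugate

namespace Summit.RiemannHypothesis.RiemannHypothesis.Theorems.SignConeConeMagnification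

variable {g : ℝ → ℂ}

/-! ### The explicit formula for `L_c` against a damped test, at fixed damping `δ` -/

/-- **Damped fake explicit formula** (fixed `0 < δ < 1/2`): for a real weight `c` with
`Σ|c(n)|n^{-σ} < ∞` (`σ > 1`), `F = L_c − 1/(s−1)` holomorphic on `Re s > 1/2` with the Carathéodory
majorant (digamma form), a test function `S` and the damped test `K(u) = e^{-δu} S(u)`:
`2π Σₙ c(n) n^{-1/2} K(log n) = ∫ F(1/2+δ+iy) Ŝ(1/2+iy) dy + ∫ Ŝ(1/2+iy)/(δ−1/2+iy) dy + 2π Ŝ(1−δ)`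
(right edge on `Re s = 2`, `L_c = F + 1/(s−1)`, shift of `F K̂` to `Re s = 1/2+δ` where `K̂ = Ŝ(· − δ)`,
and the two readings of the pole part). [folklore] -/
theorem fake_explicit_damped {c : ℕ → ℝ} {F : ℂ → ℂ}
    (hsum : ∀ σ : ℝ, 1 < σ → LSeriesSummable (fun n => ((c n : ℝ) : ℂ)) σ)
    (hFd : DifferentiableOn ℂ F {s : ℂ | 1 / 2 < s.re})
    (hFL : ∀ s : ℂ, 1 < s.re → F s = LSeries (fun n => ((c n : ℝ) : ℂ)) s - 1 / (s - 1))
    (hFA : ∀ s : ℂ, 1 / 2 < s.re →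
      (F s).re ≤ 1 / 2 + (1 / s).re + (digamma (s / 2)).re / 2 - Real.log π / 2)
    {S : ℝ → ℂ} (hS : IsWeilTest S) {δ : ℝ} (hδ : 0 < δ) (hδ2 : δ < 1 / 2) :
    2 * π * ∑' n : ℕ, ((c n : ℝ) : ℂ) / (Real.sqrt n : ℂ) *
        (cexp (-((δ : ℂ) * (Real.log n : ℝ))) * S (Real.log n)) =
      (∫ y : ℝ, F (((1 / 2 + δ : ℝ) : ℂ) + y * I) * weilMellin S (1 / 2 + y * I)) +
      (∫ y : ℝ, weilMellin S (1 / 2 + y * I) / (((1 / 2 + δ : ℝ) : ℂ) + y * I - 1)) +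
      2 * π * weilMellin S (1 - δ) := by
  set K : ℝ → ℂ := fun u => cexp (-((δ : ℂ) * u)) * S u with hK
  have hKt : IsWeilTest K := isWeilTest_expDamp hS δ
  -- growth of `F` on `[1/2 + δ, 2]`
  obtain ⟨C, hC0, hC⟩ := norm_le_linear_of_cara hsum hFd hFL hFA hδ
  -- right edge on `Re s = 2`
  have hedge := integral_LSeries_mul_weilMellin_vertical hKt (a := fun n => ((c n : ℝ) : ℂ)) (σ := 2)
    (hsum 2 (by norm_num))
  -- `L_c = F + 1/(s-1)` on the line
  have hsplit : ∀ y : ℝ, LSeries (fun n => ((c n : ℝ) : ℂ)) (((2 : ℝ) : ℂ) + y * I) =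
      F (((2 : ℝ) : ℂ) + y * I) + 1 / (((2 : ℝ) : ℂ) + y * I - 1) := by
    intro y
    rw [hFL _ (by simp)]
    ring
  have hcontF : Continuous fun y : ℝ => F (((2 : ℝ) : ℂ) + y * I) := by
    refine hFd.continuousOn.comp_continuous (by fun_prop) fun y => ?_
    simp only [mem_setOf_eq, add_re, ofReal_re, mul_re, I_re, mul_zero, ofReal_im, I_im, mul_one,
      sub_self, add_zero]
    norm_num
  have hiF : Integrable fun y : ℝ => F (((2 : ℝ) : ℂ) + y * I) * weilMellin K (((2 : ℝ) : ℂ) + y * I) :=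
    integrable_mul_weilMellin_vertical_of_norm_le_linear hKt 2 hcontF (hC 2 (by linarith) le_rfl)
  have hiP : Integrable fun y : ℝ => weilMellin K (((2 : ℝ) : ℂ) + y * I) / (((2 : ℝ) : ℂ) + y * I - 1) :=
    integrable_weilMellin_vertical_div_sub hKt (c := 2) (a := 1) (by simp)
  have hL : (∫ y : ℝ, LSeries (fun n => ((c n : ℝ) : ℂ)) (((2 : ℝ) : ℂ) + y * I) *
      weilMellin K (((2 : ℝ) : ℂ) + y * I)) =
      (∫ y : ℝ, F (((2 : ℝ) : ℂ) + y * I) * weilMellin K (((2 : ℝ) : ℂ) + y * I)) +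
      ∫ y : ℝ, weilMellin K (((2 : ℝ) : ℂ) + y * I) / (((2 : ℝ) : ℂ) + y * I - 1) := by
    rw [← integral_add hiF hiP]
    refine integral_congr_ae (Eventually.of_forall fun y => ?_)
    simp only [hsplit]
    ring
  -- shift `F K̂` to `Re s = 1/2 + δ`
  have hshift := integral_mul_weilMellin_vertical_shift hKt (F := F) (a := 1 / 2) (σ₁ := 1 / 2 + δ)
    (σ₂ := 2) (C := C) (by linarith) (by linarith) hFd hC0 hC
  -- the pole part
  have hpole := integral_weilMellin_vertical_div_sub_sub hKt (c₁ := 1 / 2 + δ) (c₂ := 2) (a := 1)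
    (by simp; linarith) (by simp)
  -- values of `K̂`
  have hKline : ∀ y : ℝ, weilMellin K (((1 / 2 + δ : ℝ) : ℂ) + y * I) = weilMellin S (1 / 2 + y * I) :=
    fun y => weilMellin_expDamp_line δ S y
  have hK1 : weilMellin K 1 = weilMellin S (1 - δ) := by
    rw [hK, weilMellin_expDamp]
  -- assemble
  have e2 : ((2 : ℝ) : ℂ) = 2 := by push_cast; ring
  rw [e2] at hedge hL hshift hpole
  simp only [hKline] at hshift hpole
  rw [sub_eq_iff_eq_add] at hpole
  rw [← hedge, hL, hshift, hpole, hK1]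
  ring

/-! ### Real parts at fixed `δ`: the one-sided majorant enters -/

/-- Integrability of the majorant kernel against the critical-line weight: for `0 ≤ δ ≤ 1/4` and a test
function `S` with `Ŝ(1/2+iy) = P(y)` real,
`y ↦ (1/2 + Re(1/s) + ½Re ψ(s/2) − ½log π + Re(1/(s−1))) P(y)`, `s = 1/2+δ+iy`, is integrable, and bounded by
an integrable function independent of `δ`. [folklore] -/
theorem exists_integrable_bound_caraKernel {S : ℝ → ℂ} (hS : IsWeilTest S) {P : ℝ → ℝ}
    (hP : ∀ y : ℝ, weilMellin S (1 / 2 + y * I) = P y) :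
    ∃ B : ℝ → ℝ, Integrable B ∧ ∀ δ : ℝ, 0 ≤ δ → δ ≤ 1 / 4 → ∀ y : ℝ,
      ‖(1 / 2 + (1 / ((((1 / 2 + δ : ℝ) : ℂ) + y * I))).re +
          (digamma ((((1 / 2 + δ : ℝ) : ℂ) + y * I) / 2)).re / 2 - Real.log π / 2 +
          (1 / ((((1 / 2 + δ : ℝ) : ℂ) + y * I) - 1)).re) * P y‖ ≤ B y := by
  obtain ⟨C, hC0, hC⟩ := exists_norm_digamma_strip_le
  -- the bound `(7 + C/2 + log π/2 + log(1+|y|)) |P y|`, integrable by the log-growth lemma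
  set C' : ℝ := 7 + C / 2 + Real.log π / 2 with hC'
  have hlogc : Continuous fun y : ℝ => Real.log (1 + |y|) :=
    Continuous.log (by fun_prop) fun y => by positivity
  have hint : Integrable fun y : ℝ => (((C' + Real.log (1 + |y|) : ℝ) : ℂ)) * weilMellin S (1 / 2 + y * I) := by
    have h := integrable_mul_weilMellin_vertical_of_norm_le_log hS (1 / 2)
      (F := fun y : ℝ => (((C' + Real.log (1 + |y|) : ℝ) : ℂ))) (by fun_prop) (C := |C'|) fun y => by
        rw [norm_real, Real.norm_eq_abs]
        have h0 : 0 ≤ Real.log (1 + |y|) := Real.log_nonneg (by linarith [abs_nonneg y])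
        rw [abs_le]; constructor <;> linarith [le_abs_self C', neg_abs_le C']
    have e : ((1 / 2 : ℝ) : ℂ) = 1 / 2 := by push_cast; ring
    simpa only [e] using h
  refine ⟨fun y => (C' + Real.log (1 + |y|)) * |P y|, ?_, fun δ hδ0 hδ4 y => ?_⟩
  · have h2 := hint.norm
    refine h2.congr (Eventually.of_forall fun y => ?_)
    have h0 : 0 ≤ Real.log (1 + |y|) := Real.log_nonneg (by linarith [abs_nonneg y])
    have hC'0 : 0 ≤ C' := by
      have : 0 ≤ Real.log π := Real.log_nonneg (by linarith [Real.pi_gt_three])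
      positivity
    simp only [hP, norm_mul, norm_real, Real.norm_eq_abs]
    rw [abs_of_nonneg (by linarith)]
  · set s : ℂ := (((1 / 2 + δ : ℝ) : ℂ) + y * I) with hs
    have hsre : s.re = 1 / 2 + δ := by simp [hs]
    have hsim : s.im = y := by simp [hs]
    have h1 : |(1 / s).re| ≤ 2 := by
      refine (abs_re_le_norm _).trans ?_
      rw [norm_div, norm_one, div_le_iff₀ (lt_of_lt_of_le (by linarith) (re_le_norm s) : (0:ℝ) < ‖s‖)]
      have := re_le_norm s
      rw [hsre] at this
      have hn : 0 ≤ ‖s‖ := norm_nonneg s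
      nlinarith
    have h2 : |(1 / (s - 1)).re| ≤ 4 := by
      refine (abs_re_le_norm _).trans ?_
      have hre : (s - 1).re = δ - 1 / 2 := by simp [hsre]; ring
      have hn : 1 / 4 ≤ ‖s - 1‖ := by
        have := abs_re_le_norm (s - 1)
        rw [hre, abs_of_nonpos (by linarith)] at this
        linarith
      rw [norm_div, norm_one, div_le_iff₀ (by linarith)]
      linarith
    have h3 : |(digamma (s / 2)).re| ≤ C + Real.log (1 + |y|) := by
      refine (abs_re_le_norm _).trans ((hC (s / 2) (by simp [hsre]; linarith) (by simp [hsre]; linarith)).trans ?_)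
      have : |(s / 2).im| ≤ |y| := by
        simp only [div_ofNat_im, hsim, abs_div, abs_two]
        linarith [abs_nonneg y]
      linarith [Real.log_le_log (by positivity) (by linarith : 1 + |(s / 2).im| ≤ 1 + |y|)]
    have h4 : 0 ≤ Real.log π := Real.log_nonneg (by linarith [Real.pi_gt_three])
    rw [norm_mul, Real.norm_eq_abs, Real.norm_eq_abs]
    refine mul_le_mul_of_nonneg_right ?_ (abs_nonneg _)
    have h0 : 0 ≤ Real.log (1 + |y|) := Real.log_nonneg (by linarith [abs_nonneg y])
    rw [abs_le]
    constructor
    · have := (abs_le.1 h1).1; have := (abs_le.1 h2).1; have := (abs_le.1 h3).1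
      rw [hC']; linarith
    · have := (abs_le.1 h1).2; have := (abs_le.1 h2).2; have := (abs_le.1 h3).2
      rw [hC']; linarith

/-- Continuity of the majorant kernel `s ↦ 1/2 + Re(1/s) + ½Re ψ(s/2) − ½log π + Re(1/(s−1))` on
`0 < Re s < 1`. [folklore] -/
theorem continuousOn_caraKernel :
    ContinuousOn (fun s : ℂ => 1 / 2 + (1 / s).re + (digamma (s / 2)).re / 2 - Real.log π / 2 +
      (1 / (s - 1)).re) {s : ℂ | 0 < s.re ∧ s.re < 1} := by
  have hψ : ContinuousOn (fun s : ℂ => digamma (s / 2)) {s : ℂ | 0 < s.re ∧ s.re < 1} := by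
    refine Literature.Analysis.SpecialFunctions.Complex.continuousOn_digamma.comp
      (continuousOn_id.div_const 2) fun s hs => ?_
    simp only [mem_setOf_eq, div_ofNat_re]
    linarith [hs.1]
  have h1 : ContinuousOn (fun s : ℂ => 1 / s) {s : ℂ | 0 < s.re ∧ s.re < 1} :=
    continuousOn_const.div continuousOn_id fun s hs h0 => by
      have := hs.1; rw [h0] at this; simp at this
  have h2 : ContinuousOn (fun s : ℂ => 1 / (s - 1)) {s : ℂ | 0 < s.re ∧ s.re < 1} :=
    continuousOn_const.div (continuousOn_id.sub continuousOn_const) fun s hs h0 => by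
      have := hs.2; rw [sub_eq_zero.1 h0] at this; simp at this
  exact ((((continuousOn_const.add (continuous_re.comp_continuousOn h1)).add
    ((continuous_re.comp_continuousOn hψ).div_const 2)).sub continuousOn_const).add
    (continuous_re.comp_continuousOn h2))

/-- **The one-sided majorant enters** (fixed `0 < δ < 1/2`): with `S` a test function whose transform is
real and nonnegative on the critical line, `Ŝ(1/2+iy) = P(y) ≥ 0`,
`2π Re Σₙ c(n) n^{-1/2} e^{-δ log n} S(log n) ≤ ∫ (A(s) + Re(1/(s−1))) P(y) dy + 2π Re Ŝ(1−δ)`,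
`s = 1/2+δ+iy`, `A(s) = 1/2 + Re(1/s) + ½Re ψ(s/2) − ½log π`. [folklore] -/
theorem re_fake_explicit_damped_le {c : ℕ → ℝ} {F : ℂ → ℂ}
    (hsum : ∀ σ : ℝ, 1 < σ → LSeriesSummable (fun n => ((c n : ℝ) : ℂ)) σ)
    (hFd : DifferentiableOn ℂ F {s : ℂ | 1 / 2 < s.re})
    (hFL : ∀ s : ℂ, 1 < s.re → F s = LSeries (fun n => ((c n : ℝ) : ℂ)) s - 1 / (s - 1))
    (hFA : ∀ s : ℂ, 1 / 2 < s.re →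
      (F s).re ≤ 1 / 2 + (1 / s).re + (digamma (s / 2)).re / 2 - Real.log π / 2)
    {S : ℝ → ℂ} (hS : IsWeilTest S) {P : ℝ → ℝ} (hP : ∀ y : ℝ, weilMellin S (1 / 2 + y * I) = P y)
    (hP0 : ∀ y : ℝ, 0 ≤ P y) {δ : ℝ} (hδ : 0 < δ) (hδ4 : δ ≤ 1 / 4) :
    2 * π * (∑' n : ℕ, ((c n : ℝ) : ℂ) / (Real.sqrt n : ℂ) *
        (cexp (-((δ : ℂ) * (Real.log n : ℝ))) * S (Real.log n))).re ≤
      (∫ y : ℝ, (1 / 2 + (1 / ((((1 / 2 + δ : ℝ) : ℂ) + y * I))).re +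
          (digamma ((((1 / 2 + δ : ℝ) : ℂ) + y * I) / 2)).re / 2 - Real.log π / 2 +
          (1 / ((((1 / 2 + δ : ℝ) : ℂ) + y * I) - 1)).re) * P y) +
      2 * π * (weilMellin S (1 - δ)).re := by
  have hδ2 : δ < 1 / 2 := by linarith
  have hid := fake_explicit_damped hsum hFd hFL hFA hS hδ hδ2
  set K : ℝ → ℂ := fun u => cexp (-((δ : ℂ) * u)) * S u with hK
  have hKt : IsWeilTest K := isWeilTest_expDamp hS δ
  set sδ : ℝ → ℂ := fun y => (((1 / 2 + δ : ℝ) : ℂ) + y * I) with hsδ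
  have hsre : ∀ y, (sδ y).re = 1 / 2 + δ := fun y => by simp [hsδ]
  -- continuity of `y ↦ F(sδ y)` and growth
  obtain ⟨C, hC0, hC⟩ := norm_le_linear_of_cara hsum hFd hFL hFA hδ
  have hcontF : Continuous fun y : ℝ => F (sδ y) := by
    refine hFd.continuousOn.comp_continuous (by fun_prop) fun y => ?_
    simp only [mem_setOf_eq, hsre]; linarith
  -- integrability of the three real integrands
  have hiF : Integrable fun y : ℝ => F (sδ y) * (P y : ℂ) := by
    have h := integrable_mul_weilMellin_vertical_of_norm_le_linear hKt (1 / 2 + δ) hcontF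
      (hC (1 / 2 + δ) le_rfl (by linarith))
    refine h.congr (Eventually.of_forall fun y => ?_)
    simp only [hK, weilMellin_expDamp_line, hP]
  have hiA : Integrable fun y : ℝ => (((1 / 2 + (1 / sδ y).re + (digamma (sδ y / 2)).re / 2 -
      Real.log π / 2 : ℝ) : ℂ)) * (P y : ℂ) := by
    obtain ⟨Cψ, _, hCψ⟩ := exists_norm_digamma_strip_le
    have hcont : Continuous fun y : ℝ => (((1 / 2 + (1 / sδ y).re + (digamma (sδ y / 2)).re / 2 -
        Real.log π / 2 : ℝ) : ℂ)) := by
      refine continuous_ofReal.comp ?_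
      have hmem : ∀ y : ℝ, sδ y ∈ {s : ℂ | 0 < s.re ∧ s.re < 1} := fun y => by
        simp only [mem_setOf_eq, hsre]; constructor <;> linarith
      have h := continuousOn_caraKernel.comp_continuous (f := sδ) (by fun_prop) hmem
      have h2 : Continuous fun y : ℝ => (1 / (sδ y - 1)).re := by
        refine continuous_re.comp (continuous_const.div (by fun_prop) fun y h0 => ?_)
        have := congrArg Complex.re h0
        simp [hsre] at this
        linarith
      have h3 := h.sub h2
      refine h3.congr fun y => ?_
      simp only [Pi.sub_apply, Function.comp_apply]
      ring
    have h := integrable_mul_weilMellin_vertical_of_norm_le_log hS (1 / 2) hcont (C := 5 / 2 + Cψ / 2 +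
      Real.log π / 2) fun y => by
        rw [norm_real, Real.norm_eq_abs]
        have h1 : |(1 / sδ y).re| ≤ 2 := by
          refine (abs_re_le_norm _).trans ?_
          have hn : 1 / 2 < ‖sδ y‖ := lt_of_lt_of_le (by rw [hsre]; linarith) (re_le_norm _)
          rw [norm_div, norm_one, div_le_iff₀ (by linarith)]
          linarith
        have h3 : |(digamma (sδ y / 2)).re| ≤ Cψ + Real.log (1 + |y|) := by
          refine (abs_re_le_norm _).trans ((hCψ (sδ y / 2) (by simp [hsre]; linarith)
            (by simp [hsre]; linarith)).trans ?_)
          have : |(sδ y / 2).im| ≤ |y| := by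
            simp only [div_ofNat_im, hsδ, add_im, ofReal_im, mul_im, ofReal_re, I_im, mul_one, I_re,
              mul_zero, add_zero, zero_add, abs_div, abs_two]
            linarith [abs_nonneg y]
          linarith [Real.log_le_log (by positivity) (by linarith : 1 + |(sδ y / 2).im| ≤ 1 + |y|)]
        have h4 : 0 ≤ Real.log π := Real.log_nonneg (by linarith [Real.pi_gt_three])
        have h0 : 0 ≤ Real.log (1 + |y|) := Real.log_nonneg (by linarith [abs_nonneg y])
        rw [abs_le]; constructor
        · have := (abs_le.1 h1).1; have := (abs_le.1 h3).1; linarith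
        · have := (abs_le.1 h1).2; have := (abs_le.1 h3).2; linarith
    have e : ((1 / 2 : ℝ) : ℂ) = 1 / 2 := by push_cast; ring
    simpa only [e, hP] using h
  have hiQ : Integrable fun y : ℝ => (P y : ℂ) / (sδ y - 1) := by
    have h := integrable_weilMellin_vertical_div_sub hKt (c := 1 / 2 + δ) (a := 1) (by simp; linarith)
    refine h.congr (Eventually.of_forall fun y => ?_)
    simp only [hK, weilMellin_expDamp_line, hP, hsδ]
  -- real parts
  have hre1 : (∫ y : ℝ, F (sδ y) * (P y : ℂ)).re = ∫ y : ℝ, (F (sδ y)).re * P y := by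
    have h := integral_re hiF
    simp only [RCLike.re_to_complex] at h
    rw [← h]
    refine integral_congr_ae (Eventually.of_forall fun y => ?_)
    simp
  have hre2 : (∫ y : ℝ, (P y : ℂ) / (sδ y - 1)).re = ∫ y : ℝ, (1 / (sδ y - 1)).re * P y := by
    have h := integral_re hiQ
    simp only [RCLike.re_to_complex] at h
    rw [← h]
    refine integral_congr_ae (Eventually.of_forall fun y => ?_)
    simp only [div_eq_mul_inv, re_ofReal_mul, one_mul]
    ring
  have hreA : ∀ y : ℝ, ((((1 / 2 + (1 / sδ y).re + (digamma (sδ y / 2)).re / 2 -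
      Real.log π / 2 : ℝ) : ℂ)) * (P y : ℂ)).re =
      (1 / 2 + (1 / sδ y).re + (digamma (sδ y / 2)).re / 2 - Real.log π / 2) * P y := fun y => by
    rw [← ofReal_mul, ofReal_re]
  -- the one-sided bound, integrated against `P ≥ 0`
  have hmono : (∫ y : ℝ, (F (sδ y)).re * P y) ≤
      ∫ y : ℝ, (1 / 2 + (1 / sδ y).re + (digamma (sδ y / 2)).re / 2 - Real.log π / 2) * P y := by
    refine integral_mono ?_ ?_ fun y => ?_
    · have := hiF.re
      refine this.congr (Eventually.of_forall fun y => ?_)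
      simp
    · have := hiA.re
      refine this.congr (Eventually.of_forall fun y => ?_)
      simp only [RCLike.re_to_complex, hreA]
    · exact mul_le_mul_of_nonneg_right (hFA _ (by rw [hsre]; linarith)) (hP0 y)
  -- combine
  have h2π : (2 : ℂ) * π = ((2 * π : ℝ) : ℂ) := by push_cast; ring
  have hL : (2 * π * ∑' n : ℕ, ((c n : ℝ) : ℂ) / (Real.sqrt n : ℂ) *
      (cexp (-((δ : ℂ) * (Real.log n : ℝ))) * S (Real.log n))).re =
      2 * π * (∑' n : ℕ, ((c n : ℝ) : ℂ) / (Real.sqrt n : ℂ) *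
        (cexp (-((δ : ℂ) * (Real.log n : ℝ))) * S (Real.log n))).re := by
    rw [h2π, re_ofReal_mul]
  rw [← hL, hid]
  simp only [hP]
  rw [add_re, add_re, h2π, re_ofReal_mul, hre1, hre2]
  have hiAr : Integrable fun y : ℝ => (1 / 2 + (1 / sδ y).re + (digamma (sδ y / 2)).re / 2 -
      Real.log π / 2) * P y := by
    have := hiA.re
    refine this.congr (Eventually.of_forall fun y => ?_)
    simp only [RCLike.re_to_complex, hreA]
  have hiQr : Integrable fun y : ℝ => (1 / (sδ y - 1)).re * P y := by
    have := hiQ.re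
    refine this.congr (Eventually.of_forall fun y => ?_)
    simp only [RCLike.re_to_complex, div_eq_mul_inv, re_ofReal_mul, one_mul]
    ring
  have hsum_int : (∫ y : ℝ, (1 / 2 + (1 / sδ y).re + (digamma (sδ y / 2)).re / 2 - Real.log π / 2 +
      (1 / (sδ y - 1)).re) * P y) =
      (∫ y : ℝ, (1 / 2 + (1 / sδ y).re + (digamma (sδ y / 2)).re / 2 - Real.log π / 2) * P y) +
      ∫ y : ℝ, (1 / (sδ y - 1)).re * P y := by
    rw [← integral_add hiAr hiQr]
    refine integral_congr_ae (Eventually.of_forall fun y => ?_)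
    ring
  simp only [hsδ] at hsum_int hmono ⊢
  rw [hsum_int]
  linarith

/-- **Anchor (registered sub-goal `caraDamped` of stmt-RiemannHypothesis-16303)**: binder-free restatement of
`fake_explicit_damped`. [folklore] -/
theorem caraDamped :
    ∀ c : ℕ → ℝ, (∀ σ : ℝ, 1 < σ → LSeriesSummable (fun n => ((c n : ℝ) : ℂ)) σ) → ∀ F : ℂ → ℂ,
      DifferentiableOn ℂ F {s : ℂ | 1 / 2 < s.re} →
      (∀ s : ℂ, 1 < s.re → F s = LSeries (fun n => ((c n : ℝ) : ℂ)) s - 1 / (s - 1)) →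
      (∀ s : ℂ, 1 / 2 < s.re →
        (F s).re ≤ 1 / 2 + (1 / s).re + (Complex.digamma (s / 2)).re / 2 - Real.log Real.pi / 2) →
      ∀ S : ℝ → ℂ, IsWeilTest S → ∀ δ : ℝ, 0 < δ → δ < 1 / 2 →
        2 * Real.pi * ∑' n : ℕ, ((c n : ℝ) : ℂ) / (Real.sqrt n : ℂ) *
            (Complex.exp (-((δ : ℂ) * (Real.log n : ℝ))) * S (Real.log n)) =
          (∫ y : ℝ, F (((1 / 2 + δ : ℝ) : ℂ) + y * Complex.I) * weilMellin S (1 / 2 + y * Complex.I)) +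
          (∫ y : ℝ, weilMellin S (1 / 2 + y * Complex.I) / (((1 / 2 + δ : ℝ) : ℂ) + y * Complex.I - 1)) +
          2 * Real.pi * weilMellin S (1 - δ) :=
  fun _ hsum _ hFd hFL hFA _ hS _ hδ hδ2 => fake_explicit_damped hsum hFd hFL hFA hS hδ hδ2

end Summit.RiemannHypothesis.RiemannHypothesis.Theorems.SignConeConeMagnification

end
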